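import Literature.Analysis.UnboundedOperators.HeatKernelDirichletForm
import Literature.Analysis.FluidPDE.GaussianVortexPlanar

/-!
# The Poincaré inequality for the Gaussian vortex weight (spectral gap of `L` in `L²(G⁻¹)`)

Companion of `Literature.Analysis.FluidPDE.GaussianVortexPlanar` (named facts
`GallayWayne2006_thm11`, `GallayMaekawa2016_thm41`; work unit `provefact GallayMaekawa2016_thm41`).
The Gaussian vortex `G(x) = (4π)⁻¹e^{−|x|²/4}` is the heat kernel of `ℝ²` at time `1`
(`gaussVortexProfile_eq_heatKernel_one`), so the Gaussian Poincaré inequality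
`Literature.Analysis.UnboundedOperators.sq_integral_heatKernel_poincare` gives

`∫ h² G − (∫ h G)² ≤ 2 ∫ ‖Dh‖² G`  for `h ∈ C¹(ℝ²)` with `h`, `Dh` bounded
(`sq_integral_gaussVortexProfile_poincare`), and for MEAN-ZERO `h` (`∫ hG = 0`) the spectral-gap
estimate `∫ h²G ≤ 2∫‖Dh‖²G` (`integral_sq_mul_gaussVortexProfile_le`). In the variables
`w = Gh ∈ X = L²(G⁻¹dx)` of Gallay–Wayne this reads `‖w‖²_X ≤ −2⟨Lw, w⟩_X` on
`{∫ w = 0} = G^⊥`, `L = Δ + ½x·∇ + 1` (`strainedVorticityOperator 0`), i.e. the spectral bound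
`L ≤ −½` on mean-zero vorticities (Gallay–Wayne 2005, Prop. 4.1 / App. A: `σ(L) = {−n/2}` in
`L²(∞)`; Gallay–Wayne 2006, §2; Gallay–Maekawa 2016, §2.2), the linear mechanism behind the
existence and stability theory of Burgers and Lamb–Oseen vortices. The Dirichlet-form version
with the conjugated operator `G⁻¹L(G·) = Δ − ½x·∇` (Gallay–Wayne 2005, (73):
`L = G^{1/2}(Δ − |x|²/16 + ½)G^{−1/2}`, equivalently `G⁻¹LG = Δ − ½x·∇` on profiles) is
`integral_laplacian_sub_half_drift_mul_mul_gaussVortexProfile` (`= −∫‖Dh‖²G`) and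
`integral_sq_mul_gaussVortexProfile_le_dirichlet` (`∫h²G ≤ −2∫(Δh − ½Dh(x)[x]) h G` on
mean-zero `h`), from `Literature.Analysis.UnboundedOperators.HeatKernelDirichletForm`.

## References

* Th. Gallay, C. E. Wayne, *Global stability of vortex solutions of the two-dimensional
  Navier–Stokes equation*, Comm. Math. Phys. 255 (2005) 97–129, Prop. 4.1 and App. A.
* Th. Gallay, C. E. Wayne, *Existence and stability of asymmetric Burgers vortices*, J. Math.
  Fluid Mech. 9 (2007), §2. [GallayWayne2006]
* Th. Gallay, Y. Maekawa, *Existence and stability of viscous vortices*, arXiv:1610.08384, §2.2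
  (spectrum of `L` in `L²(∞)`), §4. [GallayMaekawa2016]
-/

noncomputable section

open Set Function Filter MeasureTheory Metric
open scoped InnerProductSpace RealInnerProductSpace Topology Laplacian

namespace Literature.Analysis.FluidPDE

open Literature.Analysis.UnboundedOperators

/-- The Gaussian vortex is the planar heat kernel at time one: `G = heatKernel 1` on `ℝ²`
(`(4π·1)^{−2/2} e^{−|x|²/(4·1)}`). [folklore] -/
theorem gaussVortexProfile_eq_heatKernel_one :
    gaussVortexProfile = heatKernel (E := EuclideanSpace ℝ (Fin 2)) 1 := by
  funext ξ
  rw [gaussVortexProfile, heatKernel, finrank_euclideanSpace_fin]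
  norm_num [Real.rpow_neg_one, neg_div]

/-- **Poincaré inequality for the Gaussian vortex weight** (sharp constant `2` = the variance of
`G(x)dx` per direction): for `h ∈ C¹(ℝ²)` with `h` and `Dh` bounded,
`∫ h² G − (∫ h G)² ≤ 2 ∫ ‖Dh‖² G`. [folklore] -/
theorem sq_integral_gaussVortexProfile_poincare {h : EuclideanSpace ℝ (Fin 2) → ℝ}
    (hh : ContDiff ℝ 1 h) {C₀ C₁ : ℝ} (h0 : ∀ z, ‖h z‖ ≤ C₀) (h1 : ∀ z, ‖fderiv ℝ h z‖ ≤ C₁) :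
    (∫ x, h x ^ 2 * gaussVortexProfile x) - (∫ x, h x * gaussVortexProfile x) ^ 2 ≤
      2 * ∫ x, ‖fderiv ℝ h x‖ ^ 2 * gaussVortexProfile x := by
  have := sq_integral_heatKernel_poincare (E := EuclideanSpace ℝ (Fin 2)) one_pos hh h0 h1
  rw [mul_one] at this
  simpa only [gaussVortexProfile_eq_heatKernel_one] using this

/-- **Spectral gap of `L = Δ + ½x·∇ + 1` in `L²(G⁻¹)`, quadratic-form version on the profile
side**: for MEAN-ZERO `h ∈ C¹(ℝ²)` (`∫ hG = 0`, i.e. `w = Gh ⟂ G` in `X = L²(G⁻¹dx)`) with `h`,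
`Dh` bounded, `∫ h² G ≤ 2 ∫ ‖Dh‖² G`, i.e. `‖w‖²_X ≤ −2⟨Lw, w⟩_X` since
`−⟨Lw, w⟩_X = ∫‖∇h‖²G` (Gallay–Wayne 2005, App. A; Gallay–Maekawa 2016, §2.2).
[cite: GallayMaekawa2016, §2.2] -/
theorem integral_sq_mul_gaussVortexProfile_le {h : EuclideanSpace ℝ (Fin 2) → ℝ}
    (hh : ContDiff ℝ 1 h) {C₀ C₁ : ℝ} (h0 : ∀ z, ‖h z‖ ≤ C₀) (h1 : ∀ z, ‖fderiv ℝ h z‖ ≤ C₁)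
    (hmean : ∫ x, h x * gaussVortexProfile x = 0) :
    ∫ x, h x ^ 2 * gaussVortexProfile x ≤ 2 * ∫ x, ‖fderiv ℝ h x‖ ^ 2 * gaussVortexProfile x := by
  have := sq_integral_gaussVortexProfile_poincare hh h0 h1
  rw [hmean] at this
  simpa using this

/-- **Dirichlet form of the conjugated operator `G⁻¹LG = Δ − ½x·∇`** on the Gaussian vortex
weight: for `h ∈ C²(ℝ²)` with `h, Dh, D²h` bounded,
`∫ (Δh − ½ Dh(x)[x]) h G = −∫ ‖Dh‖² G` (so `⟨Lw, w⟩_{L²(G⁻¹)} = −∫‖∇h‖²G ≤ 0` for `w = Gh`: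
`L` is dissipative in `X`). [folklore] -/
theorem integral_laplacian_sub_half_drift_mul_mul_gaussVortexProfile
    {h : EuclideanSpace ℝ (Fin 2) → ℝ} (hh : ContDiff ℝ 2 h) {C₀ C₁ C₂ : ℝ} (h0 : ∀ z, ‖h z‖ ≤ C₀)
    (h1 : ∀ z, ‖fderiv ℝ h z‖ ≤ C₁) (h2 : ∀ z, ‖fderiv ℝ (fderiv ℝ h) z‖ ≤ C₂) :
    ∫ x, (Δ h x - 2⁻¹ * fderiv ℝ h x x) * h x * gaussVortexProfile x =
      -∫ x, ‖fderiv ℝ h x‖ ^ 2 * gaussVortexProfile x := by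
  have := integral_ornsteinUhlenbeck_mul_mul_heatKernel (E := EuclideanSpace ℝ (Fin 2)) one_pos
    hh h0 h1 h2
  rw [mul_one] at this
  simpa only [gaussVortexProfile_eq_heatKernel_one] using this

/-- **Spectral gap of `L = Δ + ½x·∇ + 1` in `L²(G⁻¹)`, Dirichlet-form version**: for
`h ∈ C²(ℝ²)` with `h, Dh, D²h` bounded and `∫ hG = 0` (i.e. `w = Gh` has zero mass, `w ⟂ G` in
`X = L²(G⁻¹dx)`), `∫ h²G ≤ −2 ∫ (Δh − ½Dh(x)[x]) h G`, that is `‖w‖²_X ≤ −2⟨Lw, w⟩_X`: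
the spectrum of `L` on `G^⊥ ⊂ X` lies in `(−∞, −½]` at the level of quadratic forms
(Gallay–Wayne 2005, Prop. 4.1; Gallay–Maekawa 2016, §2.2). [cite: GallayMaekawa2016, §2.2] -/
theorem integral_sq_mul_gaussVortexProfile_le_dirichlet
    {h : EuclideanSpace ℝ (Fin 2) → ℝ} (hh : ContDiff ℝ 2 h) {C₀ C₁ C₂ : ℝ} (h0 : ∀ z, ‖h z‖ ≤ C₀)
    (h1 : ∀ z, ‖fderiv ℝ h z‖ ≤ C₁) (h2 : ∀ z, ‖fderiv ℝ (fderiv ℝ h) z‖ ≤ C₂)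
    (hmean : ∫ x, h x * gaussVortexProfile x = 0) :
    ∫ x, h x ^ 2 * gaussVortexProfile x ≤
      -2 * ∫ x, (Δ h x - 2⁻¹ * fderiv ℝ h x x) * h x * gaussVortexProfile x := by
  have hm : ∫ x, h x * heatKernel (E := EuclideanSpace ℝ (Fin 2)) 1 x = 0 := by
    rw [← gaussVortexProfile_eq_heatKernel_one]; exact hmean
  have := integral_sq_mul_heatKernel_le_dirichlet (E := EuclideanSpace ℝ (Fin 2)) one_pos
    hh h0 h1 h2 hm
  rw [mul_one] at this
  simpa only [gaussVortexProfile_eq_heatKernel_one] using this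

end Literature.Analysis.FluidPDE
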